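import Mathlib
import HarnessLib

/-!
# LINE (A) `product_plus_one` — r = 1 rung: power-sum inequalities for the «other rows» of pen THEOREM E∞ (definition-free)

Crux item stmt-ValiantsHypothesis-18050 (`MatrixDescartes`), LINE (A) `Lines/product_plus_one.lean` (skeleton 4c66814e33f05045), floor
`OneChangeFloorK3`, r = 1 rung, ΩLC for EVERY k.  The vertex/edge certificates `…ZeroChangeStateVertexCert` / `…EdgeCertParts` take as
hypotheses that `p₁..p₄` are power sums of NONNEGATIVE reals: `p_n ≥ 0`, `p₂ ≤ p₁²`, `p₃ ≤ p₁p₂` (pen val-idea-25 g9 §56.24 (4): «p = power sums of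
ANY family of nonnegative reals — every negative monomial is charged via `p_{a+b} ≤ p_a·p_b` chains»).  THIS FILE proves those hypotheses for
an arbitrary finset of rows (as needed for `p^(i) = Σ_{j ≠ i}` and `p^(ij) = Σ_{l ≠ i,j}`, i.e. sums over `Finset.univ.erase i` (`.erase j`)):
`sum_sq_le_sq_sum` (`Σ e² ≤ (Σ e)²`) and `sum_cube_le_sum_mul_sum_sq` (`Σ e³ ≤ (Σ e)(Σ e²)`) for `e ≥ 0` on the finset, by induction on the finset.
Remaining kernel debt of THEOREM E∞ for every `k` (not here): the simplex-Bernstein aggregation identity and the assembly with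
`OmegaLogConcave_of_GPos` (`…ZeroChangeStateReduction`).

No `def`, no named fact, no sorry; imports Mathlib only.  HONEST FRAMING: elementary helper inequalities; nothing here closes
`stub_oneChangeFloorK3` or any stub of LINE (A); 18050 / `MatrixDescartes` OPEN; `VP ≠ VNP` is NOT proved.
-/

set_option linter.dupNamespace false

namespace Summit.ValiantsHypothesis.ValiantsHypothesis.Theorems.LacunarySymmetroidMatrixDescartes

namespace ZeroChangeState

open Finset
open scoped BigOperators

/-- `p₂ ≤ p₁²`: for nonnegative reals on a finset, `Σ e_j² ≤ (Σ e_j)²`. -/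
theorem sum_sq_le_sq_sum {ι : Type*} [DecidableEq ι] (s : Finset ι) (e : ι → ℝ) (h : ∀ j ∈ s, 0 ≤ e j) :
    ∑ j ∈ s, e j ^ 2 ≤ (∑ j ∈ s, e j) ^ 2 := by
  induction s using Finset.induction_on with
  | empty => simp
  | insert a s ha ih =>
    rw [Finset.sum_insert ha, Finset.sum_insert ha]
    have ha0 : 0 ≤ e a := h a (Finset.mem_insert_self a s)
    have hs0 : 0 ≤ ∑ j ∈ s, e j := Finset.sum_nonneg (fun j hj => h j (Finset.mem_insert_of_mem hj))
    have ih' := ih (fun j hj => h j (Finset.mem_insert_of_mem hj))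
    nlinarith [mul_nonneg ha0 hs0]

/-- `p₃ ≤ p₁·p₂`: for nonnegative reals on a finset, `Σ e_j³ ≤ (Σ e_j)·(Σ e_j²)`. -/
theorem sum_cube_le_sum_mul_sum_sq {ι : Type*} [DecidableEq ι] (s : Finset ι) (e : ι → ℝ) (h : ∀ j ∈ s, 0 ≤ e j) :
    ∑ j ∈ s, e j ^ 3 ≤ (∑ j ∈ s, e j) * (∑ j ∈ s, e j ^ 2) := by
  induction s using Finset.induction_on with
  | empty => simp
  | insert a s ha ih =>
    rw [Finset.sum_insert ha, Finset.sum_insert ha, Finset.sum_insert ha]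
    have ha0 : 0 ≤ e a := h a (Finset.mem_insert_self a s)
    have hs0 : 0 ≤ ∑ j ∈ s, e j := Finset.sum_nonneg (fun j hj => h j (Finset.mem_insert_of_mem hj))
    have hs2 : 0 ≤ ∑ j ∈ s, e j ^ 2 := Finset.sum_nonneg (fun j _ => sq_nonneg (e j))
    have ih' := ih (fun j hj => h j (Finset.mem_insert_of_mem hj))
    nlinarith [mul_nonneg ha0 hs2, mul_nonneg (sq_nonneg (e a)) hs0]

/-- `p_n ≥ 0` for the power sums used (`n = 1, 2, 3, 4`), nonnegative reals on a finset. -/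
theorem sum_pow_nonneg_of_nonneg {ι : Type*} (s : Finset ι) (e : ι → ℝ) (h : ∀ j ∈ s, 0 ≤ e j) (n : ℕ) :
    0 ≤ ∑ j ∈ s, e j ^ n :=
  Finset.sum_nonneg (fun j hj => pow_nonneg (h j hj) n)

/-- The «other rows» power sums of a feasible state: for `i ∈ univ`, `Σ_{j ≠ i} e_jⁿ = (Σ_j e_jⁿ) − e_iⁿ` (bookkeeping for `p^(i)`). -/
theorem sum_erase_pow_eq {k : ℕ} (E : Fin k → ℝ) (i : Fin k) (n : ℕ) :
    ∑ j ∈ Finset.univ.erase i, E j ^ n = (∑ j, E j ^ n) - E i ^ n := by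
  rw [Finset.sum_erase_eq_sub (Finset.mem_univ i)]

end ZeroChangeState

end Summit.ValiantsHypothesis.ValiantsHypothesis.Theorems.LacunarySymmetroidMatrixDescartes
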